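import Mathlib.FieldTheory.Galois.Basic
import Mathlib.Analysis.Complex.Basic
import HarnessLib

/-!
# S7a (D3 support) — the `K*`-structure of the level field `L₁ ⊂ ℂ` and the restriction `γ = σ|_{L₁}`
# (Shimura 1998, §18.6, proof of Thm. 18.6: «(ii) L is normal over ℚ … let γ be the restriction of σ to L»)

Topic `Literature/NumberTheory/ComplexMultiplication`, namespace `Literature.NumberTheory.ComplexMultiplication`.
Cell `hodgecm-mathlib`, fan B-II row II-1-S7a, FIELD SELECTION (B-p15's harness `S7aHarness.core`, stage (II)
`exists_levelField`, 2026-08-28T06:01:28Z): the core of the level-`N` step of Shimura's proof of Thm. 18.6 runs over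
an abstract level field `L₁` carrying
`[Algebra (traceField Φ) L₁] [IsScalarTower (traceField Φ) L₁ ℂ] [IsGalois (traceField Φ) L₁]` and an element
`γ : L₁ ≃ₐ[traceField Φ] L₁` with `σ (algebraMap L₁ ℂ x) = algebraMap L₁ ℂ (γ x)`.  Piece G1
(`Motives/…/MainTheoremCMLevelCommonField`) produces `L₁ : IntermediateField L ℂ`, Galois over `ℚ`, containing any
prescribed finite `E ⊇ K*`.  THIS FILE supplies the adapter: for a subfield `F ⊂ ℂ` (the reflex/trace field `K*`)
contained in an intermediate field `L₁` of `ℂ / L` that is Galois over `ℚ`, and `σ ∈ Aut(ℂ/F)`,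

* `L₁` is an `F`-algebra compatibly with `L₁ ⊂ ℂ` (`F ⊆ L₁`), Galois over `F` (tower top of `L₁/ℚ`), and
* `σ` restricts to an `F`-automorphism `γ` of `L₁` (`L₁/ℚ` normal): `σ|_{L₁} = γ`,

packed as one `∃` over the instance arguments exactly as the field-selection statement consumes them.  Shimura:
«We then take an algebraic number field L of finite degree such that … (ii) L is normal over ℚ …» and (p. 167, (3))
the use of the restriction of `σ` to `L`.

THEOREMS ONLY (no `def`, no named fact, no instance declared — the algebra structure is produced inside an `∃`).

## References

* [Shimura1998] G. Shimura, *Abelian Varieties with Complex Multiplication and Modular Functions* (Princeton 1998),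
  §18.6, proof of Thm. 18.6, conditions (ii) on the auxiliary field and step (3) (held chunks p0165–p0167).
-/

noncomputable section

namespace Literature.NumberTheory.ComplexMultiplication

/-- **Subfields `F ⊆ L₁` of `ℂ`: `L₁` is an `F`-algebra inside `ℂ`.**  For `F ⊂ ℂ` (over `ℚ`) and an intermediate
field `L₁` of `ℂ / L` with `F ⊆ L₁` as sets there is an `F`-algebra structure on `L₁` with `F → L₁ → ℂ` the
inclusions (Shimura's standing «K* ⊂ L», proof of Thm. 18.6 (iii)/(ii)). [cite: Shimura1998, §18.6 proof of Thm. 18.6 (ii)–(iii)] -/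
theorem exists_algebra_isScalarTower_of_subset (F : IntermediateField ℚ ℂ) {L : Type} [Field L] [Algebra L ℂ]
    (L₁ : IntermediateField L ℂ) (hF : (F : Set ℂ) ⊆ L₁) :
    ∃ _ : Algebra F L₁, IsScalarTower F L₁ ℂ := by
  let ψ : F →+* L₁ :=
    { toFun := fun x => ⟨(x : ℂ), hF x.2⟩
      map_one' := Subtype.ext rfl
      map_mul' := fun _ _ => Subtype.ext rfl
      map_zero' := Subtype.ext rfl
      map_add' := fun _ _ => Subtype.ext rfl }
  letI : Algebra F L₁ := ψ.toAlgebra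
  exact ⟨ψ.toAlgebra, IsScalarTower.of_algebraMap_eq fun _ => rfl⟩

/-- **The `K*`-structure of the level field and `γ = σ|_{L₁}`** (field selection of the level-`N` step).  Let
`F ⊂ ℂ` be a subfield (finite over `ℚ` or not), `L₁` an intermediate field of `ℂ / L` which is Galois over `ℚ` and
contains `F`, and `σ ∈ Aut(ℂ/F)`.  Then, for the `F`-algebra structure on `L₁` given by the inclusion
(`IsScalarTower F L₁ ℂ`), `L₁ / F` is Galois and `σ` restricts to `γ ∈ Gal(L₁/F)`:
`σ (x) = γ (x)` in `ℂ` for all `x ∈ L₁` — «L is normal over ℚ» so `σ(L) = L`.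
[cite: Shimura1998, §18.6 proof of Thm. 18.6, (ii) and (3) (held chunks p0165–p0167)] -/
theorem exists_algebra_isGalois_algEquiv_restrict (F : IntermediateField ℚ ℂ) {L : Type} [Field L] [Algebra L ℂ]
    (L₁ : IntermediateField L ℂ) [IsGalois ℚ L₁] (hF : (F : Set ℂ) ⊆ L₁) (σ : ℂ ≃ₐ[F] ℂ) :
    ∃ (_ : Algebra F L₁) (_ : IsScalarTower F L₁ ℂ) (_ : IsGalois F L₁) (γ : L₁ ≃ₐ[F] L₁),
      ∀ x : L₁, σ (algebraMap L₁ ℂ x) = algebraMap L₁ ℂ (γ x) := by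
  obtain ⟨_, _⟩ := exists_algebra_isScalarTower_of_subset F L₁ hF
  -- `ℚ → F → L₁` is a scalar tower (ring maps out of `ℚ` are unique), so `L₁/F` is Galois as a top of `L₁/ℚ`
  haveI : IsScalarTower ℚ F L₁ :=
    IsScalarTower.of_algebraMap_eq' (Subsingleton.elim _ _)
  haveI : IsGalois F L₁ := IsGalois.tower_top_of_isGalois ℚ F L₁
  -- restrict `σ` (as a `ℚ`-automorphism of `ℂ`) to the normal subextension `L₁`
  let σ₀ : ℂ ≃ₐ[ℚ] ℂ := AlgEquiv.restrictScalars ℚ σ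
  let γ₀ : L₁ ≃ₐ[ℚ] L₁ := σ₀.restrictNormal L₁
  have hγ₀ : ∀ x : L₁, algebraMap L₁ ℂ (γ₀ x) = σ (algebraMap L₁ ℂ x) := fun x =>
    AlgEquiv.restrictNormal_commutes σ₀ L₁ x
  -- `γ₀` is `F`-linear: checked in `ℂ`, where `σ` fixes `F`
  have hlin : ∀ a : F, γ₀.toRingEquiv (algebraMap F L₁ a) = algebraMap F L₁ a := fun a => by
    apply (algebraMap L₁ ℂ).injective
    change algebraMap L₁ ℂ (γ₀ (algebraMap F L₁ a)) = _
    rw [hγ₀, ← IsScalarTower.algebraMap_apply F L₁ ℂ, AlgEquiv.commutes]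
  refine ⟨‹Algebra F L₁›, ‹IsScalarTower F L₁ ℂ›, ‹IsGalois F L₁›, AlgEquiv.ofRingEquiv hlin, fun x => ?_⟩
  exact (hγ₀ x).symm

/-- The same adapter with the conclusion spelled through the coercion `L₁ → ℂ` (`σ x = γ x` in `ℂ`).
[cite: Shimura1998, §18.6 proof of Thm. 18.6, (ii) and (3) (held chunks p0165–p0167)] -/
theorem exists_algebra_isGalois_algEquiv_restrict' (F : IntermediateField ℚ ℂ) {L : Type} [Field L] [Algebra L ℂ]
    (L₁ : IntermediateField L ℂ) [IsGalois ℚ L₁] (hF : (F : Set ℂ) ⊆ L₁) (σ : ℂ ≃ₐ[F] ℂ) :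
    ∃ (_ : Algebra F L₁) (_ : IsScalarTower F L₁ ℂ) (_ : IsGalois F L₁) (γ : L₁ ≃ₐ[F] L₁),
      ∀ x : L₁, σ (x : ℂ) = (γ x : ℂ) :=
  exists_algebra_isGalois_algEquiv_restrict F L₁ hF σ

end Literature.NumberTheory.ComplexMultiplication

end
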